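import Summits.KontsevichZagierPeriods.KontsevichZagierPeriods.Theorems.LinRedNormalFormArrangementNormalFormStubRebaseSimpleZeroNestedDissect
import Summits.KontsevichZagierPeriods.KontsevichZagierPeriods.Theorems.LinRedNormalFormArrangementNormalFormStubRebaseSimplePosOneFibreSplit

/-!
# Stub `stub_rebaseSimpleZeroTwo`, part `rebaseSimpleZero_nestedCommon` (crux `ArrangementNormalForm`,
line `janus-bands`) — the part

NESTED pairs of fibres with letters of a COMMON `y`-slope over a one-dimensional base (literal
class `GS 0 2`, simple base pole): some bound of one fibre is the other fibre. Normalisation of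
the linking patterns of two fibres `tᵢ, tⱼ`:
* self-links and double links (`tⱼ < tᵢ < tⱼ`, `tᵢ < tⱼ < tᵢ`, …) have an EMPTY domain;
* the half-linked pattern `A < tᵢ < tⱼ`, `A' < tⱼ < B` (`RebaseNest.good_halfA`): cut the base by
  the sign of `A − A'` (rule 1a); where `A' < A` the domain is the clean nest `A < tᵢ < tⱼ < B`,
  where `A < A'` one cut of the fibre `i` at the level `A'` gives the product
  `{A < tᵢ < A'} × {A' < tⱼ < B}` (product case `RebaseZero.good_literal`, worker W2) and the clean
  nest `A' < tᵢ < tⱼ < B`;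
* the mirror pattern `A < tᵢ < B'`, `tᵢ < tⱼ < B` (`RebaseNest.good_halfB`) is the previous one
  after the reflection `t ↦ −t` of both fibres;
* clean nests are `RebaseNest.good_cleanNest` (joint shear + dissection of the base interval).
The pinch-vertex blow-up move (worker W4) enters as the explicit hypothesis `HBlow`
(= `RebaseNest.BlowUp`). Registered part: `rebaseSimpleZero_nestedCommon`.

References: M. Kontsevich, D. Zagier, *Periods* (2001), §1.2, rules (1a), (2).
-/

noncomputable section

open Set MeasureTheory MvPolynomial
open Literature.NumberTheory.Transcendental Literature.ModelTheory.ExponentialFields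

namespace Summit.KontsevichZagierPeriods.ArrangementNormalForm.JanusBands

namespace RebaseNest

open SeparatePos RebasePos RebaseZero

variable {m m' n₁ n₂ : ℕ} {i j : Fin 2}

/-- **The half-linked pattern `A < tᵢ < tⱼ`, `A' < tⱼ < B`** with letters of common `y`-slope is
good for `GG 0 2 2` (given the blow-up move): cut the base by the sign of `A − A'`; on `A' < A`
the domain is the clean nest `A < tᵢ < tⱼ < B`; on `A < A'` cut the fibre `i` at `A'` into the
product `{A < tᵢ < A'} × {A' < tⱼ < B}` and the clean nest `A' < tᵢ < tⱼ < B`.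
[Kontsevich–Zagier 2001, §1.2, rules (1), (2)] -/
theorem good_halfA (hB : BlowUp) (s : KZ.IntegralRep (0 + 1 + 2)) (M : Fin m' → Cf)
    (L : Fin m → (Fin 0 → ℚ) × ℚ) (e : Fin m → ℕ) (p : MvPolynomial (Fin 0) ℚ) (ℓ₁ ℓ₂ : (Fin 0 → ℚ) × ℚ)
    (a : Fin 2 → Option Cf) (lo hi : Fin 2 → Fin 2 ⊕ Cf) (hij : i ≠ j) (A A' B : Cf) (h1 : n₁ = 0) (hn : n₂ = 1)
    (hbd : Bornology.IsBounded s.domain) (hdom : s.domain = gDom 0 2 m' M lo hi)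
    (hint : EqOn s.integrand (glit 0 2 p L e ℓ₁ ℓ₂ n₁ n₂ a) s.domain)
    (hloi : lo i = Sum.inr A) (hhii : hi i = Sum.inl j) (hloj : lo j = Sum.inr A') (hhij : hi j = Sum.inr B)
    (lam : ℚ) (ha : ∀ l c, a l = some c → c.1 (Fin.last 0) = lam) : Good 2 (KZ.of s) := by
  -- membership in the half-nested domain over any rows
  have memS : ∀ {m₁ : ℕ} (M₁ : Fin m₁ → Cf) (z : Fin (0 + 1 + 2) → ℝ), z ∈ gDom 0 2 m₁ M₁ lo hi ↔
      yv z ∈ cell M₁ ∧ (ev A (yv z) < tv z i ∧ tv z i < tv z j) ∧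
        (ev A' (yv z) < tv z j ∧ tv z j < ev B (yv z)) := by
    intro m₁ M₁ z
    rw [mem_gDom_pair hij, hloi, hhii, hloj, hhij, rows_iff]
    simp only [RebaseNest.pv_inr, RebaseNest.pv_inl, affF_eq]
    rfl
  -- clean nests `A₁ < tᵢ < tⱼ < B` are good
  have clean : ∀ {m₁ : ℕ} (M₁ : Fin m₁ → Cf) (r : KZ.IntegralRep (0 + 1 + 2)) (A₁ : Cf),
      Bornology.IsBounded r.domain → EqOn r.integrand (glit 0 2 p L e ℓ₁ ℓ₂ n₁ n₂ a) r.domain →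
      r.domain = gDom 0 2 m₁ M₁ (nlo i A₁) (nhi j B) → Good 2 (KZ.of r) := fun M₁ r A₁ hb hi' hd =>
    good_cleanNest hB r M₁ L e p ℓ₁ ℓ₂ a (nlo i A₁) (nhi j B) hij A₁ B h1 hn hb hd hi' (nlo_self i A₁)
      (nhi_of_ne hij B) (nlo_of_ne hij A₁) (nhi_self j B) lam ha
  by_cases hAA : A = A'
  · subst hAA
    refine clean M s A hbd hint ?_
    rw [hdom]
    ext z
    rw [memS, mem_nDom hij]
    constructor
    · rintro ⟨hy, ⟨h1', h2⟩, -, h4⟩; exact ⟨hy, h1', h2, h4⟩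
    · rintro ⟨hy, h1', h2, h4⟩; exact ⟨hy, ⟨h1', h2⟩, h1'.trans h2, h4⟩
  -- cut the base at `A - A'`
  obtain ⟨s₁, s₂, hm₁, hm₂, hi₁, hi₂, hd₁, hd₂, hrel⟩ := cutBase s M lo hi hdom (A - A') (sub_ne_zero.2 hAA)
  have hs₁ : s₁.domain ⊆ s.domain := fun z hz => ((hm₁ z).1 hz).1
  have hs₂ : s₂.domain ⊆ s.domain := fun z hz => ((hm₂ z).1 hz).1
  have hint₁ : EqOn s₁.integrand (glit 0 2 p L e ℓ₁ ℓ₂ n₁ n₂ a) s₁.domain := fun z hz => by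
    rw [hi₁]; exact hint (hs₁ hz)
  have hint₂ : EqOn s₂.integrand (glit 0 2 p L e ℓ₁ ℓ₂ n₁ n₂ a) s₂.domain := fun z hz => by
    rw [hi₂]; exact hint (hs₂ hz)
  refine good_of_rel3 hrel ?_ ?_
  · -- `A' < A`: the clean nest `A < tᵢ < tⱼ < B`
    refine clean (Fin.snoc M (A - A') : Fin (m' + 1) → Cf) s₁ A (hbd.subset hs₁) hint₁ ?_
    rw [hd₁]
    ext z
    rw [memS, mem_nDom hij, mem_cell_snoc, ev_sub, sub_pos]
    constructor
    · rintro ⟨⟨hy, hr⟩, ⟨h1', h2⟩, -, h4⟩; exact ⟨⟨hy, hr⟩, h1', h2, h4⟩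
    · rintro ⟨⟨hy, hr⟩, h1', h2, h4⟩; exact ⟨⟨hy, hr⟩, ⟨h1', h2⟩, (hr.trans h1').trans h2, h4⟩
  · -- `A < A'`: cut the fibre `i` at `A'`
    have memP : ∀ z, z ∈ gDom 0 2 (m' + 1) (Fin.snoc M (-(A - A')) : Fin (m' + 1) → Cf) lo
        (Function.update hi i (Sum.inr A')) ↔ (yv z ∈ cell M ∧ ev A (yv z) < ev A' (yv z)) ∧
        (ev A (yv z) < tv z i ∧ tv z i < ev A' (yv z)) ∧ (ev A' (yv z) < tv z j ∧ tv z j < ev B (yv z)) := by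
      intro z
      rw [mem_gDom_pair hij, hloi, Function.update_self, hloj, Function.update_of_ne hij.symm, hhij, rows_iff,
        mem_cell_snoc, ev_neg, ev_sub]
      simp only [RebaseNest.pv_inr, affF_eq, neg_sub, sub_pos]
      rfl
    have memN : ∀ z, z ∈ gDom 0 2 (m' + 1) (Fin.snoc M (-(A - A')) : Fin (m' + 1) → Cf)
        (Function.update lo i (Sum.inr A')) hi ↔ (yv z ∈ cell M ∧ ev A (yv z) < ev A' (yv z)) ∧
        (ev A' (yv z) < tv z i ∧ tv z i < tv z j) ∧ (ev A' (yv z) < tv z j ∧ tv z j < ev B (yv z)) := by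
      intro z
      rw [mem_gDom_pair hij, Function.update_self, hhii, Function.update_of_ne hij.symm, hloj, hhij, rows_iff,
        mem_cell_snoc, ev_neg, ev_sub]
      simp only [RebaseNest.pv_inr, RebaseNest.pv_inl, affF_eq, neg_sub, sub_pos]
      rfl
    obtain ⟨s₃, s₄, hd₃, hd₄, hi₃, hi₄, hs₃, hs₄, hrel'⟩ := cutFibre s₂ (Fin.snoc M (-(A - A')) : Fin (m' + 1) → Cf)
      lo hi hd₂ i A' (fun z hz => by
        obtain ⟨-, -, h3, -⟩ := (memP z).1 hz
        rw [hhii, RebaseNest.pv_inl, affF_eq]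
        exact h3.le)
      (fun z hz => by
        obtain ⟨⟨-, hr⟩, -, -⟩ := (memN z).1 hz
        rw [hloi, RebaseNest.pv_inr, affF_eq, affF_eq]
        exact hr.le)
    refine good_of_rel3 hrel' ?_ ?_
    · -- the product `{A < tᵢ < A'} × {A' < tⱼ < B}`
      refine good_literal s₃ (Fin.snoc M (-(A - A')) : Fin (m' + 1) → Cf) L e p ℓ₁ ℓ₂ a lo
        (Function.update hi i (Sum.inr A')) (Or.inl h1) (fun l => ?_) ((hbd.subset hs₂).subset hs₃) hd₃
        fun z hz => by rw [hi₃]; exact hint₂ (hs₃ hz)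
      rcases (fin_two_eq_or hij l).imp Eq.symm Eq.symm with rfl | rfl
      · exact ⟨⟨A, hloi⟩, ⟨A', by simp⟩⟩
      · exact ⟨⟨A', hloj⟩, ⟨B, by rw [Function.update_of_ne hij.symm, hhij]⟩⟩
    · -- the clean nest `A' < tᵢ < tⱼ < B`
      refine clean (Fin.snoc M (-(A - A')) : Fin (m' + 1) → Cf) s₄ A' ((hbd.subset hs₂).subset hs₄)
        (fun z hz => by rw [hi₄]; exact hint₂ (hs₄ hz)) ?_
      rw [hd₄]
      ext z
      rw [memN, mem_nDom hij, mem_cell_snoc, ev_neg, ev_sub, neg_sub, sub_pos]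
      constructor
      · rintro ⟨hy, ⟨h1', h2⟩, -, h4⟩; exact ⟨hy, h1', h2, h4⟩
      · rintro ⟨hy, h1', h2, h4⟩; exact ⟨hy, ⟨h1', h2⟩, h1'.trans h2, h4⟩

/-- **The half-linked pattern `A < tᵢ < B'`, `tᵢ < tⱼ < B`** with letters of common `y`-slope is
good for `GG 0 2 2` (given the blow-up move): the reflection `t ↦ −t` of both fibres turns it
into the pattern of `good_halfA`. [Kontsevich–Zagier 2001, §1.2, rules (1), (2)] -/
theorem good_halfB (hB : BlowUp) (s : KZ.IntegralRep (0 + 1 + 2)) (M : Fin m' → Cf)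
    (L : Fin m → (Fin 0 → ℚ) × ℚ) (e : Fin m → ℕ) (p : MvPolynomial (Fin 0) ℚ) (ℓ₁ ℓ₂ : (Fin 0 → ℚ) × ℚ)
    (a : Fin 2 → Option Cf) (lo hi : Fin 2 → Fin 2 ⊕ Cf) (hij : i ≠ j) (A B' B : Cf) (h1 : n₁ = 0) (hn : n₂ = 1)
    (hbd : Bornology.IsBounded s.domain) (hdom : s.domain = gDom 0 2 m' M lo hi)
    (hint : EqOn s.integrand (glit 0 2 p L e ℓ₁ ℓ₂ n₁ n₂ a) s.domain)
    (hloi : lo i = Sum.inr A) (hhii : hi i = Sum.inr B') (hloj : lo j = Sum.inl i) (hhij : hi j = Sum.inr B)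
    (lam : ℚ) (ha : ∀ l c, a l = some c → c.1 (Fin.last 0) = lam) : Good 2 (KZ.of s) := by
  obtain ⟨s', -, hbd', hdom', hint', hrel⟩ := pull (fun _ : Fin 2 => (-1 : ℚ)) (fun _ => 0) (fun _ => 0)
    s M L e p ℓ₁ ℓ₂ n₁ n₂ a lo hi hbd hdom hint (fun _ => by norm_num) (hlink_const (-1) 0 _ _)
  have hneg : ¬ (0 : ℚ) < -1 := by norm_num
  refine good_of_sub_mem hrel (good_halfA hB s' M L e _ ℓ₁ ℓ₂ _ _ _ hij.symm (-B) (-B') (-A) h1 hn hbd' hdom'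
    hint' ?_ ?_ ?_ ?_ (-lam) fun l c hc => ?_)
  · simp only [pullLo, hneg, if_false, hhij, Sum.map_inr, pullC_neg_one]
  · simp only [pullHi, hneg, if_false, hloj, Sum.map_inl, id]
  · simp only [pullLo, hneg, if_false, hhii, Sum.map_inr, pullC_neg_one]
  · simp only [pullHi, hneg, if_false, hloi, Sum.map_inr, pullC_neg_one]
  · rcases h : a l with _ | c₀
    · simp [pullA, h] at hc
    · simp only [pullA, h, Option.map_some, Option.some.injEq] at hc
      rw [← hc, pullC_fst_last, ha l c₀ h, sub_zero, div_neg, div_one]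

/-- **Nested pairs with letters of a common `y`-slope** (literal `GS 0 2` datum, simple base
pole): normalisation of the linking patterns (empty / half-linked / clean), then
`good_halfA/B` and `good_cleanNest`. [Kontsevich–Zagier 2001, §1.2, rules (1), (2)] -/
theorem good_nestedCommon (hB : BlowUp) (s : KZ.IntegralRep (0 + 1 + 2)) (M : Fin m' → Cf)
    (L : Fin m → (Fin 0 → ℚ) × ℚ) (e : Fin m → ℕ) (p : MvPolynomial (Fin 0) ℚ) (ℓ₁ ℓ₂ : (Fin 0 → ℚ) × ℚ)
    (a : Fin 2 → Option Cf) (lo hi : Fin 2 → Fin 2 ⊕ Cf) (h12 : n₁ = 0 ∨ n₂ = 0) (hn : n₂ = 1)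
    (hbd : Bornology.IsBounded s.domain) (hdom : s.domain = gDom 0 2 m' M lo hi)
    (hint : EqOn s.integrand (glit 0 2 p L e ℓ₁ ℓ₂ n₁ n₂ a) s.domain)
    (hnest : ∃ i j : Fin 2, i ≠ j ∧ (hi i = Sum.inl j ∨ lo j = Sum.inl i))
    (hlam : ∃ lam : ℚ, ∀ l c, a l = some c → c.1 (Fin.last 0) = lam) : Good 2 (KZ.of s) := by
  obtain ⟨i, j, hij, hlink⟩ := hnest
  obtain ⟨lam, ha⟩ := hlam
  have h1 : n₁ = 0 := h12.resolve_right (by rw [hn]; exact one_ne_zero)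
  have mem := fun z => mem_gDom_pair hij M lo hi z
  have empty : (∀ z, z ∈ gDom 0 2 m' M lo hi → False) → Good 2 (KZ.of s) := fun h =>
    good_of_dom_empty s fun z hz => h z (hdom ▸ hz)
  rcases hli : lo i with l | A
  · -- `lo i` is a fibre: empty
    refine empty fun z hz => ?_
    obtain ⟨-, ⟨h1i, h2i⟩, ⟨h1j, -⟩⟩ := (mem z).1 hz
    rw [hli, RebaseNest.pv_inl] at h1i
    rcases (fin_two_eq_or hij l).imp Eq.symm Eq.symm with rfl | rfl
    · exact lt_irrefl _ h1i
    · rcases hlink with h | h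
      · rw [h, RebaseNest.pv_inl] at h2i; exact lt_asymm h1i h2i
      · rw [h, RebaseNest.pv_inl] at h1j; exact lt_asymm h1i h1j
  rcases hhj : hi j with l | B
  · -- `hi j` is a fibre: empty
    refine empty fun z hz => ?_
    obtain ⟨-, ⟨-, h2i⟩, ⟨h1j, h2j⟩⟩ := (mem z).1 hz
    rw [hhj, RebaseNest.pv_inl] at h2j
    rcases (fin_two_eq_or hij l).imp Eq.symm Eq.symm with rfl | rfl
    · rcases hlink with h | h
      · rw [h, RebaseNest.pv_inl] at h2i; exact lt_asymm h2j h2i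
      · rw [h, RebaseNest.pv_inl] at h1j; exact lt_asymm h2j h1j
    · exact lt_irrefl _ h2j
  rcases hhi' : hi i with l | B'
  · rcases (fin_two_eq_or hij l).imp Eq.symm Eq.symm with rfl | rfl
    · -- `hi i = tᵢ`: empty
      refine empty fun z hz => ?_
      obtain ⟨-, ⟨-, h2i⟩, -⟩ := (mem z).1 hz
      rw [hhi', RebaseNest.pv_inl] at h2i
      exact lt_irrefl _ h2i
    · rcases hlj : lo j with l' | A'
      · rcases (fin_two_eq_or hij l').imp Eq.symm Eq.symm with rfl | rfl
        · -- clean nest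
          exact good_cleanNest hB s M L e p ℓ₁ ℓ₂ a lo hi hij A B h1 hn hbd hdom hint hli hhi' hlj hhj lam ha
        · -- `lo j = tⱼ`: empty
          refine empty fun z hz => ?_
          obtain ⟨-, -, ⟨h1j, -⟩⟩ := (mem z).1 hz
          rw [hlj, RebaseNest.pv_inl] at h1j
          exact lt_irrefl _ h1j
      · -- half-linked: `A < tᵢ < tⱼ`, `A' < tⱼ < B`
        exact good_halfA hB s M L e p ℓ₁ ℓ₂ a lo hi hij A A' B h1 hn hbd hdom hint hli hhi' hlj hhj lam ha
  · rcases hlj : lo j with l' | A'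
    · rcases (fin_two_eq_or hij l').imp Eq.symm Eq.symm with rfl | rfl
      · -- half-linked: `A < tᵢ < B'`, `tᵢ < tⱼ < B`
        exact good_halfB hB s M L e p ℓ₁ ℓ₂ a lo hi hij A B' B h1 hn hbd hdom hint hli hhi' hlj hhj lam ha
      · -- `lo j = tⱼ`: empty
        refine empty fun z hz => ?_
        obtain ⟨-, -, ⟨h1j, -⟩⟩ := (mem z).1 hz
        rw [hlj, RebaseNest.pv_inl] at h1j
        exact lt_irrefl _ h1j
    · -- no link at all: excluded
      exfalso
      rcases hlink with h | h
      · rw [hhi'] at h; cases h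
      · rw [hlj] at h; cases h

end RebaseNest

/-- **Registered part `rebaseSimpleZero_nestedCommon` of `stub_rebaseSimpleZeroTwo` (line
`janus-bands`): nested pairs with letters of a common `y`-slope.** A representation with the
literal `GS 0 2` datum (one base coordinate `y` in a bounded rational cell, base factor
`p/∏ Lⱼ^{eⱼ} · (y − ℓ₁)^{n₁}/(y − ℓ₂)^{n₂}` with `n₂ = 1`, two fibres `tᵢ` with optional letters
`1/(tᵢ − cᵢ(y))`) in which some bound of one fibre is the other fibre (`hnest`) and whose letters
have a COMMON `y`-slope (`hlam`) is congruent modulo `KZ.relations` to a `ℤ`-combination of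
elements of the rebased literal class `SeparatePos.GGset 0 2 2` (constant letters, bounds
constant or exactly `y`) — GIVEN the pinch-vertex blow-up move of worker W4 as the hypothesis
`HBlow` (a clean nest over the two-row cell `{0 < ε₁ (y − y₀) < ε}` whose bounds pass through the
vertex `(y₀, t₀)` and open upwards, base pole at `y₀`, constant letters equal to `t₀` except on at
most one fibre, is good). Proof: empty linking patterns, half-linked patterns (one base cut, one
fibre cut, product case of worker W2), clean nests (joint shear, explicit dissection of the base
interval into empty / thick-separable / pinch pieces; pinch pieces by sub-section Janus with the
cone estimate, super-section Janus with the log-cone estimate, or `HBlow`).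
[Kontsevich–Zagier 2001, §1.2, rules (1), (2)] -/
theorem rebaseSimpleZero_nestedCommon (m m' n₁ n₂ : ℕ) (s : KZ.IntegralRep (0 + 1 + 2)) (M : Fin m' → (Fin (0 + 1) → ℚ) × ℚ) (L : Fin m → (Fin 0 → ℚ) × ℚ) (e : Fin m → ℕ) (p : MvPolynomial (Fin 0) ℚ) (ℓ₁ ℓ₂ : (Fin 0 → ℚ) × ℚ) (a : Fin 2 → Option ((Fin (0 + 1) → ℚ) × ℚ)) (lo hi : Fin 2 → Fin 2 ⊕ ((Fin (0 + 1) → ℚ) × ℚ)) (h12 : n₁ = 0 ∨ n₂ = 0) (hn : n₂ = 1) (hbd : Bornology.IsBounded s.domain) (hdom : s.domain = {z | (∀ j, 0 < ∑ i, ((M j).1 i : ℝ) * z (Fin.castAdd 2 i) + ((M j).2 : ℝ)) ∧ ∀ i, Sum.elim (fun j => z (Fin.natAdd (0 + 1) j)) (fun c => ∑ i', (c.1 i' : ℝ) * z (Fin.castAdd 2 i') + (c.2 : ℝ)) (lo i) < z (Fin.natAdd (0 + 1) i) ∧ z (Fin.natAdd (0 + 1) i) < Sum.elim (fun j => z (Fin.natAdd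 (0 + 1) j)) (fun c => ∑ i', (c.1 i' : ℝ) * z (Fin.castAdd 2 i') + (c.2 : ℝ)) (hi i)}) (hint : EqOn s.integrand (fun z => MvPolynomial.aeval (fun i => z (Fin.castAdd 2 (Fin.castSucc i))) p / (∏ j, (∑ i, ((L j).1 i : ℝ) * z (Fin.castAdd 2 (Fin.castSucc i)) + ((L j).2 : ℝ)) ^ e j) * ((z (Fin.castAdd 2 (Fin.last 0)) - (∑ i, (ℓ₁.1 i : ℝ) * z (Fin.castAdd 2 (Fin.castSucc i)) + (ℓ₁.2 : ℝ))) ^ n₁ / (z (Fin.castAdd 2 (Fin.last 0)) - (∑ i, (ℓ₂.1 i : ℝ) * z (Fin.castAdd 2 (Fin.castSucc i)) + (ℓ₂.2 : ℝ))) ^ n₂) * ∏ i, (a i).elim 1 (fun c => 1 / (z (Fin.natAdd (0 + 1) i) - (∑ i', (c.1 i' : ℝ) * z (Fin.castAdd 2 i') + (c.2 : ℝ))))) s.domain) (hnest : ∃ i j : Fin 2, i ≠ j ∧ (hi i = Sum.inl j ∨ lo j = Sum.inl i)) (hlam : ∃ lam : ℚ, ∀ i c, a i = some c → c.1 (Fin.last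 0) = lam) (HBlow : ∀ (m : ℕ) (s : KZ.IntegralRep (0 + 1 + 2)) (L : Fin m → (Fin 0 → ℚ) × ℚ) (e : Fin m → ℕ) (p : MvPolynomial (Fin 0) ℚ) (ℓ₁ ℓ₂ : (Fin 0 → ℚ) × ℚ) (n₁ n₂ : ℕ) (a : Fin 2 → Option ((Fin (0 + 1) → ℚ) × ℚ)) (lo hi : Fin 2 → Fin 2 ⊕ ((Fin (0 + 1) → ℚ) × ℚ)) (i j : Fin 2) (A Bd : (Fin (0 + 1) → ℚ) × ℚ) (y₀ t₀ ε ε₁ : ℚ), i ≠ j → lo i = Sum.inr A → hi i = Sum.inl j → lo j = Sum.inl i → hi j = Sum.inr Bd → n₁ = 0 → n₂ = 1 → 0 < ε → (ε₁ = 1 ∨ ε₁ = -1) → ℓ₂.2 = y₀ → A.1 (Fin.last 0) * y₀ + A.2 = t₀ → Bd.1 (Fin.last 0) * y₀ + Bd.2 = t₀ → 0 < ε₁ * A.1 (Fin.last 0) → ε₁ * A.1 (Fin.last 0) < ε₁ * Bd.1 (Fin.last 0) → (∀ l c, a l = some c → c.1 (Fin.last 0) = 0) → (∃ l₀ : Fin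 2, ∀ l c, l ≠ l₀ → a l = some c → c.2 = t₀) → Bornology.IsBounded s.domain → s.domain = SeparatePos.gDom 0 2 2 ![RebaseZero.mk ε₁ (-(ε₁ * y₀)), RebaseZero.mk (-ε₁) (ε₁ * y₀ + ε)] lo hi → EqOn s.integrand (RebasePos.glit 0 2 p L e ℓ₁ ℓ₂ n₁ n₂ a) s.domain → ∃ c ∈ AddSubgroup.closure (SeparatePos.GGset 0 2 2), KZ.of s - c ∈ KZ.relations) : ∃ c ∈ AddSubgroup.closure (SeparatePos.GGset 0 2 2), KZ.of s - c ∈ KZ.relations :=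
  RebaseNest.good_nestedCommon HBlow s M L e p ℓ₁ ℓ₂ a lo hi h12 hn hbd hdom hint hnest hlam

end Summit.KontsevichZagierPeriods.ArrangementNormalForm.JanusBands
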